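import Summits.KontsevichZagierPeriods.KontsevichZagierPeriods.Theorems.RootDecompWalshStrataCutBall4Pieces
import Summits.KontsevichZagierPeriods.KontsevichZagierPeriods.Theorems.RootDecompWalshStrataCutBall4PairBase
import Summits.KontsevichZagierPeriods.KontsevichZagierPeriods.Theorems.RootDecompWalshStrataCutBall4WideBase

/-!
# Root decomposition on Walsh strata — part 112 (gen 13, addendum 1): the signed peel for `ρ ≤ 3`

Crux `QuadricSignKernel` (item 25393), slice `d = 4`; notation of parts 104–111.  For `ρ > 2` the
caps `K_i(ρ)` of `B₊(√ρ)` overlap and the peel `B_i = B_{i+1} ⊔ K_i` of part 106 fails.  For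
`ρ ≤ 3` the triple overlaps are empty and the peel is repaired with the pairwise overlaps
`K_{im}(ρ)` (part 108), all splits being DISJOINT two-piece partitions (rule (1a)):

* `B_i(ρ) = B_{i+1}(ρ) ⊔ L_{i,i}(ρ)` with `L_{i,m} = K_i ∩ {x_j < 1 ∀ j < m}` (`lSet`), every `ρ`;
* `L_{i,m} = L_{i,m+1} ⊔ K_{im}` for `m < i` and `ρ ≤ 3` (a point of `K_{im}` has all other
  coordinates `< 1`), and `L_{i,0} = K_i`;

so that `[C_ρ] = [B_4] = [B_0] − Σᵢ [L_{i,i}]`, `[L_{i,i}] = [K_i] − Σ_{m<i} [K_{im}]` inside the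
rules.  Also: `bRepW = [B_i(ρ), q]` for `ρ ≤ 4`, its dilation from the unit ball cell, the swap
congruences of the wide caps, and the permutation congruences `[K_{01}] ≡ [K_{im}]` (`pairPerm`).
[KontsevichZagier2001 §1.2 rules (1), (2); BCR1998 §2.1]
-/

noncomputable section

open Literature.NumberTheory.Transcendental
open MeasureTheory Set
open MvPolynomial (aeval X C)
open Literature.ModelTheory.ExponentialFields (IsSemialgebraic isSemialgebraic_setOf_eval_lt)
open Summit.KontsevichZagierPeriods.RootDecompWalshStrata.WalshSpanProof (cellRep cellRep_domain
  cellRep_integrand)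
open Summit.KontsevichZagierPeriods.RootDecompWalshStrata.Ball4 (ball4Poly aeval_ball4Poly)
open Summit.KontsevichZagierPeriods.RootDecompWalshStrata.ConicDescent (bddRep bddRep_domain bddRep_integrand)

namespace Summit.KontsevichZagierPeriods.RootDecompWalshStrata.CutBall4

variable {ρ : ℚ}

open Literature.NumberTheory.Transcendental in
open MeasureTheory Set in
open MvPolynomial (aeval X C) in
open Literature.ModelTheory.ExponentialFields (IsSemialgebraic isSemialgebraic_setOf_eval_pos isSemialgebraic_setOf_eval_nonneg isSemialgebraic_setOf_eval_lt) in
open Summit.KontsevichZagierPeriods.RootDecompWalshStrata.WalshSpanProof (cellRep cellRep_domain cellRep_integrand isSemialgebraic_cubeSet isBounded_cubeSet) in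
open Summit.KontsevichZagierPeriods.RootDecompWalshStrata.ConicDescent (bddRep bddRep_domain bddRep_integrand) in
open Summit.KontsevichZagierPeriods.RootDecompWalshStrata.Ball4 (ball4Poly aeval_ball4Poly) in
/-- A single square is at most `nsq`. [elementary] -/
private theorem sq_le_nsq (x : Fin 4 → ℝ) (j : Fin 4) : x j ^ 2 ≤ nsq x := by
  rw [nsq_eq_sum]
  exact Finset.single_le_sum (f := fun i => x i ^ 2) (fun i _ => sq_nonneg (x i)) (Finset.mem_univ j)

/-! #### The peeled orthants for `ρ ≤ 4` -/

/-- `B_i(ρ) ⊆ [0, 2]⁴` for `ρ ≤ 4`. [folklore] -/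
theorem bSet_subset_Icc_of_le_four (h4 : ρ ≤ 4) (i : ℕ) : bSet ρ i ⊆ Icc 0 2 := by
  intro x hx
  obtain ⟨⟨hpos, hn⟩, -⟩ := hx
  have h4' : (ρ : ℝ) ≤ 4 := by exact_mod_cast h4
  refine ⟨fun j => (hpos j).le, fun j => ?_⟩
  have hj := sq_le_nsq x j
  change x j ≤ 2
  nlinarith [hpos j]

/-- `B_i(ρ)` is bounded (`ρ ≤ 4`). [folklore] -/
theorem isBounded_bSet_of_le_four (h4 : ρ ≤ 4) (i : ℕ) : Bornology.IsBounded (bSet ρ i) :=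
  (isCompact_Icc (a := (0 : Fin 4 → ℝ)) (b := 2)).isBounded.subset (bSet_subset_Icc_of_le_four h4 i)

/-- **`bRepW ρ q i = [B_i(ρ), q]`**, constant rational weight `q`, every `ρ ≤ 4`. [KontsevichZagier2001 §1.1] -/
def bRepW (ρ q : ℚ) (h4 : ρ ≤ 4) (i : ℕ) : KZ.IntegralRep 4 :=
  bddRep (bSet ρ i) (isSemialgebraic_bSet ρ i) (isBounded_bSet_of_le_four h4 i) (fun _ => (q : ℝ))
    (isSemialgebraicFunOn_ratCast (isSemialgebraic_bSet ρ i) q) |(q : ℝ)| fun _ _ => le_rfl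

/-- The domain of `bRepW`. [definition] -/
@[simp] theorem bRepW_domain (q : ℚ) (h4 : ρ ≤ 4) (i : ℕ) : (bRepW ρ q h4 i).domain = bSet ρ i := rfl

/-- The integrand of `bRepW`. [definition] -/
@[simp] theorem bRepW_integrand (q : ℚ) (h4 : ρ ≤ 4) (i : ℕ) (x : Fin 4 → ℝ) :
    (bRepW ρ q h4 i).integrand x = (q : ℝ) := rfl

/-- `[B_4(ρ), q] ≡ [C_ρ, q]` (same domain and integrand), every `ρ ≤ 4`. [KontsevichZagier2001 §1.2] -/
theorem of_bRepW_four_sub_of_cellRep_mem_relations (q : ℚ) (h4 : ρ ≤ 4) :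
    KZ.of (bRepW ρ q h4 4) - KZ.of (cellRep (cutPoly ρ) q) ∈ KZ.relations :=
  KZ.of_sub_of_mem_relations_of_eqOn (cellRep_cutPoly_domain ρ q)
    fun x _ => by rw [bRepW_integrand, cellRep_integrand]

/-- **Rule (2), dilation: `[unit ball cell, ρ²·q] − [B_0(ρ), q] ∈ relations`** (`0 < ρ ≤ 4`).
[KontsevichZagier2001 §1.2 rule (2)] -/
theorem of_ball4_cell_sub_of_bRepW_zero_mem_relations (hρ : 0 < ρ) (h4 : ρ ≤ 4) (q : ℚ) :
    KZ.of (cellRep ball4Poly (ρ ^ 2 * q)) - KZ.of (bRepW ρ q h4 0) ∈ KZ.relations := by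
  have hρ' : (0 : ℝ) < ρ := by exact_mod_cast hρ
  have hs : 0 < √(ρ : ℝ) := Real.sqrt_pos.2 hρ'
  have hp : √(ρ : ℝ) ^ 4 = (ρ : ℝ) ^ 2 := by
    rw [show (4 : ℕ) = 2 * 2 from rfl, pow_mul, Real.sq_sqrt hρ'.le]
  refine KZ.smul_sub_mem_relations (isAlgebraic_sqrt hρ.le) hs.ne' _ _
    (by rw [bRepW_domain, image_smul_ball4_cell hρ]) fun x _ => ?_
  rw [cellRep_integrand, bRepW_integrand, abs_of_nonneg hs.le, hp]
  push_cast
  ring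

/-! #### The partially peeled caps `L_{i,m}(ρ)` -/

/-- `L_{i,m}(ρ) = K_i(ρ) ∩ {x_j < 1 ∀ j < m}`: the cap `K_i` with the overlaps `K_{ij}`, `j < m`, removed. -/
def lSet (ρ : ℚ) (i : Fin 4) (m : ℕ) : Set (Fin 4 → ℝ) :=
  {x | x ∈ capSet ρ i ∧ ∀ j : Fin 4, (j : ℕ) < m → x j < 1}

/-- Membership in `L_{i,m}(ρ)`, unfolded. [definition] -/
theorem mem_lSet {i : Fin 4} {m : ℕ} {x : Fin 4 → ℝ} :
    x ∈ lSet ρ i m ↔ x ∈ capSet ρ i ∧ ∀ j : Fin 4, (j : ℕ) < m → x j < 1 := Iff.rfl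

/-- `L_{i,m}(ρ)` is `ℚ`-semialgebraic. [BCR1998 §2.1] -/
theorem isSemialgebraic_lSet (ρ : ℚ) (i : Fin 4) (m : ℕ) : IsSemialgebraic ℚ (lSet ρ i m) := by
  have h4 := IsSemialgebraic.biInter (k := ℚ) (R := ℝ)
    ((Finset.univ : Finset (Fin 4)).filter fun j : Fin 4 => j.val < m)
    (fun a => {t : Fin 4 → ℝ | aeval t (X a : MvPolynomial (Fin 4) ℚ) <
      aeval t (1 : MvPolynomial (Fin 4) ℚ)})
    (fun a _ => isSemialgebraic_setOf_eval_lt _ _)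
  convert (isSemialgebraic_capSet ρ i).inter h4 using 1
  ext x
  simp only [lSet, mem_inter_iff, mem_setOf_eq, mem_iInter, Finset.mem_filter, Finset.mem_univ,
    true_and, map_one, MvPolynomial.aeval_X]

/-- `L_{i,m}(ρ) ⊆ K_i(ρ)`. [definition] -/
theorem lSet_subset_capSet (ρ : ℚ) (i : Fin 4) (m : ℕ) : lSet ρ i m ⊆ capSet ρ i := fun _ hx => hx.1

/-- `L_{i,0}(ρ) = K_i(ρ)`. [definition] -/
theorem lSet_zero (ρ : ℚ) (i : Fin 4) : lSet ρ i 0 = capSet ρ i :=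
  Set.ext fun _ => ⟨fun hx => hx.1, fun hx => ⟨hx, fun _ hj => absurd hj (Nat.not_lt_zero _)⟩⟩

/-- **`lRep ρ q i m = [L_{i,m}(ρ), q]`**, constant rational weight `q` (`ρ ≤ 4`). [KontsevichZagier2001 §1.1] -/
def lRep (ρ q : ℚ) (h4 : ρ ≤ 4) (i : Fin 4) (m : ℕ) : KZ.IntegralRep 4 :=
  bddRep (lSet ρ i m) (isSemialgebraic_lSet ρ i m)
    ((isBounded_capSet_of_le_four h4 i).subset (lSet_subset_capSet ρ i m)) (fun _ => (q : ℝ))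
    (isSemialgebraicFunOn_ratCast (isSemialgebraic_lSet ρ i m) q) |(q : ℝ)| fun _ _ => le_rfl

/-- The domain of `lRep`. [definition] -/
@[simp] theorem lRep_domain (q : ℚ) (h4 : ρ ≤ 4) (i : Fin 4) (m : ℕ) :
    (lRep ρ q h4 i m).domain = lSet ρ i m := rfl

/-- The integrand of `lRep`. [definition] -/
@[simp] theorem lRep_integrand (q : ℚ) (h4 : ρ ≤ 4) (i : Fin 4) (m : ℕ) (x : Fin 4 → ℝ) :
    (lRep ρ q h4 i m).integrand x = (q : ℝ) := rfl

/-- `[L_{i,0}, q] ≡ [K_i, q]`. [KontsevichZagier2001 §1.2] -/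
theorem of_lRep_zero_sub_of_capRepW_mem_relations (q : ℚ) (h4 : ρ ≤ 4) (i : Fin 4) :
    KZ.of (lRep ρ q h4 i 0) - KZ.of (capRepW ρ q h4 i) ∈ KZ.relations :=
  KZ.of_sub_of_mem_relations_of_eqOn (by rw [lRep_domain, capRepW_domain, lSet_zero])
    fun x _ => by rw [lRep_integrand, capRepW_integrand]

/-! #### Rule (1a): `B_i = B_{i+1} ⊔ L_{i,i}` (every `ρ`) -/

/-- **`B_i(ρ) = B_{i+1}(ρ) ∪ L_{i,i}(ρ)`**, for every `ρ`. [elementary] -/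
theorem bSet_eq_union_lSet (ρ : ℚ) (i : Fin 4) : bSet ρ i = bSet ρ ((i : ℕ) + 1) ∪ lSet ρ i i := by
  ext x
  simp only [mem_bSet, mem_union, mem_lSet, mem_capSet]
  constructor
  · rintro ⟨⟨hpos, hn⟩, hlt⟩
    by_cases hi : x i < 1
    · refine Or.inl ⟨⟨hpos, hn⟩, fun j hj => ?_⟩
      rcases Nat.lt_succ_iff_lt_or_eq.1 hj with hj | hj
      · exact hlt j hj
      · rw [Fin.ext hj]; exact hi
    · exact Or.inr ⟨⟨hpos, not_lt.1 hi, hn⟩, hlt⟩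
  · rintro (⟨⟨hpos, hn⟩, hlt⟩ | ⟨⟨hpos, -, hn⟩, hlt⟩)
    · exact ⟨⟨hpos, hn⟩, fun j hj => hlt j (Nat.lt_succ_of_lt hj)⟩
    · exact ⟨⟨hpos, hn⟩, hlt⟩

/-- The two pieces are disjoint. [elementary] -/
theorem bSet_succ_inter_lSet (ρ : ℚ) (i : Fin 4) : bSet ρ ((i : ℕ) + 1) ∩ lSet ρ i i = ∅ :=
  Set.eq_empty_iff_forall_notMem.2 fun _ ⟨hb, hl⟩ =>
    (not_lt.2 hl.1.2.1) (hb.2 i (Nat.lt_succ_self _))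

/-- **Rule (1a): `[B_i, q] − [B_{i+1}, q] − [L_{i,i}, q] ∈ relations`**, every `ρ ≤ 4`.
[KontsevichZagier2001 §1.2 rule (1)] -/
theorem of_bRepW_sub_sub_mem_relations (q : ℚ) (h4 : ρ ≤ 4) (i : Fin 4) :
    KZ.of (bRepW ρ q h4 i) - KZ.of (bRepW ρ q h4 ((i : ℕ) + 1)) - KZ.of (lRep ρ q h4 i i) ∈
      KZ.relations :=
  KZ.domainAddRel_subset_relations ⟨4, bRepW ρ q h4 i, bRepW ρ q h4 ((i : ℕ) + 1), lRep ρ q h4 i i,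
    by rw [bRepW_domain, bRepW_domain, lRep_domain]; exact bSet_eq_union_lSet ρ i,
    by rw [bRepW_domain, lRep_domain, bSet_succ_inter_lSet]; exact measure_empty,
    fun _ _ => rfl, fun _ _ => rfl, rfl⟩

/-! #### Rule (1a): `L_{i,m} = L_{i,m+1} ⊔ K_{im}` (`m < i`, `ρ ≤ 3`) -/

/-- In the ball of radius `≤ √3`, a point with `x_i ≥ 1` and `x_m ≥ 1` (`i ≠ m`) has every other
coordinate `< 1`. [elementary] -/
theorem lt_one_of_two_le {x : Fin 4 → ℝ} (h3 : ρ ≤ 3) (hn : nsq x < ρ) {i m j : Fin 4}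
    (hi : 1 ≤ x i) (hm : 1 ≤ x m) (him : i ≠ m) (hji : j ≠ i) (hjm : j ≠ m) : x j < 1 := by
  have h3' : (ρ : ℝ) ≤ 3 := by exact_mod_cast h3
  have hsum : x j ^ 2 + (x i ^ 2 + x m ^ 2) ≤ nsq x := by
    have h := Finset.sum_le_sum_of_subset_of_nonneg (f := fun k => x k ^ 2)
      (Finset.subset_univ ({j, i, m} : Finset (Fin 4))) fun k _ _ => sq_nonneg (x k)
    have hjn : j ∉ ({i, m} : Finset (Fin 4)) := by simp [hji, hjm]
    rwa [Finset.sum_insert hjn, Finset.sum_pair him, ← nsq_eq_sum] at h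
  nlinarith

/-- **`L_{i,m}(ρ) = L_{i,m+1}(ρ) ∪ K_{im}(ρ)`** for `m < i` and `ρ ≤ 3`. [elementary] -/
theorem lSet_eq_union (h3 : ρ ≤ 3) {i m : Fin 4} (hmi : (m : ℕ) < i) :
    lSet ρ i m = lSet ρ i ((m : ℕ) + 1) ∪ pairSet ρ i m := by
  have him : i ≠ m := fun h => by rw [h] at hmi; exact lt_irrefl _ hmi
  ext x
  simp only [mem_lSet, mem_union, mem_capSet, mem_pairSet]
  constructor
  · rintro ⟨⟨hpos, hi, hn⟩, hlt⟩
    by_cases hxm : x m < 1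
    · refine Or.inl ⟨⟨hpos, hi, hn⟩, fun j hj => ?_⟩
      rcases Nat.lt_succ_iff_lt_or_eq.1 hj with hj | hj
      · exact hlt j hj
      · rw [Fin.ext hj]; exact hxm
    · exact Or.inr ⟨hpos, ⟨hi, not_lt.1 hxm⟩, hn⟩
  · rintro (⟨hK, hlt⟩ | ⟨hpos, ⟨hi, hxm⟩, hn⟩)
    · exact ⟨hK, fun j hj => hlt j (Nat.lt_succ_of_lt hj)⟩
    · refine ⟨⟨hpos, hi, hn⟩, fun j hj => ?_⟩
      have hjm : j ≠ m := fun h => by rw [h] at hj; exact lt_irrefl _ hj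
      have hji : j ≠ i := fun h => by rw [h] at hj; exact lt_asymm hmi hj
      exact lt_one_of_two_le h3 hn hi hxm him hji hjm

/-- The two pieces are disjoint. [elementary] -/
theorem lSet_succ_inter_pairSet (ρ : ℚ) (i m : Fin 4) :
    lSet ρ i ((m : ℕ) + 1) ∩ pairSet ρ i m = ∅ :=
  Set.eq_empty_iff_forall_notMem.2 fun _ ⟨hl, hp⟩ =>
    (not_lt.2 hp.2.1.2) (hl.2 m (Nat.lt_succ_self _))

/-- **Rule (1a): `[L_{i,m}, q] − [L_{i,m+1}, q] − [K_{im}, q] ∈ relations`** (`m < i`, `ρ ≤ 3`).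
[KontsevichZagier2001 §1.2 rule (1)] -/
theorem of_lRep_sub_sub_mem_relations (q : ℚ) (h3 : ρ ≤ 3) {i m : Fin 4} (hmi : (m : ℕ) < i) :
    KZ.of (lRep ρ q (le_four_of_le_three h3) i m) - KZ.of (lRep ρ q (le_four_of_le_three h3) i ((m : ℕ) + 1)) -
      KZ.of (pairRep ρ q (le_four_of_le_three h3) i m) ∈ KZ.relations :=
  KZ.domainAddRel_subset_relations ⟨4, lRep ρ q _ i m, lRep ρ q _ i ((m : ℕ) + 1), pairRep ρ q _ i m,
    by rw [lRep_domain, lRep_domain, pairRep_domain]; exact lSet_eq_union h3 hmi,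
    by rw [lRep_domain, pairRep_domain, lSet_succ_inter_pairSet]; exact measure_empty,
    fun _ _ => rfl, fun _ _ => rfl, rfl⟩

/-! #### Rule (2): congruences of the wide caps and of the overlaps -/

/-- The reindexed wide cap `capRepW … 0 ∘ (0 i)` has domain `K_i(ρ)`. [definition] -/
theorem reindex_capRepW_zero_domain (q : ℚ) (h4 : ρ ≤ 4) (i : Fin 4) :
    ((capRepW ρ q h4 0).reindex (Equiv.swap 0 i)).domain = capSet ρ i := by
  ext w
  rw [KZ.IntegralRep.reindex_domain, capRepW_domain, mem_setOf_eq]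
  exact comp_swap_mem_capSet_iff i w

/-- **Rule (2), coordinate swap: `[K_0(ρ), q] − [K_i(ρ), q] ∈ relations`** (`ρ ≤ 4`).
[KontsevichZagier2001 §1.2 rule (2)] -/
theorem of_capRepW_zero_sub_of_capRepW_mem_relations (q : ℚ) (h4 : ρ ≤ 4) (i : Fin 4) :
    KZ.of (capRepW ρ q h4 0) - KZ.of (capRepW ρ q h4 i) ∈ KZ.relations := by
  have h1 := KZ.of_sub_of_reindex_mem_relations (capRepW ρ q h4 0) (Equiv.swap 0 i)
  have h2 : KZ.of ((capRepW ρ q h4 0).reindex (Equiv.swap 0 i)) - KZ.of (capRepW ρ q h4 i) ∈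
      KZ.relations :=
    KZ.of_sub_of_mem_relations_of_eqOn
      (by rw [reindex_capRepW_zero_domain, capRepW_domain]) fun w _ => rfl
  have := add_mem h1 h2
  rwa [sub_add_sub_cancel] at this

/-- A permutation `e` of the coordinates carries `K_{e 0, e 1}(ρ)` onto `K_{01}(ρ)`. [elementary] -/
theorem comp_perm_mem_pairSet_iff (e : Equiv.Perm (Fin 4)) (w : Fin 4 → ℝ) :
    (fun j => w (e j)) ∈ pairSet ρ 0 1 ↔ w ∈ pairSet ρ (e 0) (e 1) := by
  have hs : ∑ j, w (e j) ^ 2 = ∑ j, w j ^ 2 := Equiv.sum_comp e (fun j => w j ^ 2)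
  simp only [mem_pairSet, nsq_eq_sum, hs]
  exact and_congr ⟨fun h j => by simpa using h (e.symm j), fun h j => h _⟩ Iff.rfl

/-- The reindexed overlap `pairRep … 0 1 ∘ e` has domain `K_{e 0, e 1}(ρ)`. [definition] -/
theorem reindex_pairRep_domain (q : ℚ) (h4 : ρ ≤ 4) (e : Equiv.Perm (Fin 4)) :
    ((pairRep ρ q h4 0 1).reindex e).domain = pairSet ρ (e 0) (e 1) := by
  ext w
  rw [KZ.IntegralRep.reindex_domain, pairRep_domain, mem_setOf_eq]
  exact comp_perm_mem_pairSet_iff e w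

/-- **Rule (2), coordinate permutation: `[K_{01}(ρ), q] − [K_{e 0, e 1}(ρ), q] ∈ relations`** (`ρ ≤ 4`).
[KontsevichZagier2001 §1.2 rule (2)] -/
theorem of_pairRep_zero_one_sub_of_pairRep_mem_relations (q : ℚ) (h4 : ρ ≤ 4) (e : Equiv.Perm (Fin 4)) :
    KZ.of (pairRep ρ q h4 0 1) - KZ.of (pairRep ρ q h4 (e 0) (e 1)) ∈ KZ.relations := by
  have h1 := KZ.of_sub_of_reindex_mem_relations (pairRep ρ q h4 0 1) e
  have h2 : KZ.of ((pairRep ρ q h4 0 1).reindex e) - KZ.of (pairRep ρ q h4 (e 0) (e 1)) ∈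
      KZ.relations :=
    KZ.of_sub_of_mem_relations_of_eqOn (by rw [reindex_pairRep_domain, pairRep_domain]) fun w _ => rfl
  have := add_mem h1 h2
  rwa [sub_add_sub_cancel] at this

/-- A permutation with `pairPerm i m 0 = i`, `pairPerm i m 1 = m` (`i ≠ m`). -/
def pairPerm (i m : Fin 4) : Equiv.Perm (Fin 4) :=
  (Equiv.swap (1 : Fin 4) (Equiv.swap (0 : Fin 4) i m)).trans (Equiv.swap 0 i)

/-- `pairPerm i m 0 = i` for `i ≠ m`. [elementary] -/
theorem pairPerm_zero {i m : Fin 4} (him : i ≠ m) : pairPerm i m 0 = i := by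
  fin_cases i <;> fin_cases m <;> first | exact absurd rfl him | decide

/-- `pairPerm i m 1 = m` for `i ≠ m`. [elementary] -/
theorem pairPerm_one {i m : Fin 4} (him : i ≠ m) : pairPerm i m 1 = m := by
  fin_cases i <;> fin_cases m <;> first | exact absurd rfl him | decide

/-- **`[K_{01}(ρ), q] − [K_{im}(ρ), q] ∈ relations`** for `i ≠ m` (`ρ ≤ 4`). [KontsevichZagier2001 §1.2 rule (2)] -/
theorem of_pairRep_zero_one_sub_of_pairRep_mem_relations' (q : ℚ) (h4 : ρ ≤ 4) {i m : Fin 4}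
    (him : i ≠ m) : KZ.of (pairRep ρ q h4 0 1) - KZ.of (pairRep ρ q h4 i m) ∈ KZ.relations := by
  have h := of_pairRep_zero_one_sub_of_pairRep_mem_relations q h4 (pairPerm i m) (ρ := ρ)
  rwa [pairPerm_zero him, pairPerm_one him] at h

end Summit.KontsevichZagierPeriods.RootDecompWalshStrata.CutBall4

end
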